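import Summits.CriticalPhenomena.CardyFormulaZ2.Theorems.CardyDualCurrentMartingaleToSLE6Reduction
import Summits.CriticalPhenomena.CardyFormulaZ2.Theorems.CardySelfRefinementInterfaceToCardy
import HarnessLib

/-!
# r5 `MartingaleToSLE6` — the Kemppainen–Smirnov decomposition, glue and strength certificates

Route `CardyDualCurrent` (sub-problem `CriticalPhenomena/CardyFormulaZ2`), crux
`Summit.CriticalPhenomena.CardyFormulaZ2.Theses.CardyDualCurrent.MartingaleToSLE6`
(item stmt-CriticalPhenomena-11395, `TemplateCanonicalLimit → SLE6InterfaceLimit`), strategist seat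
`cstrat-stmt-CriticalPhenomena-11395-s1` (2026-08-17). Nothing here closes the crux. This file lands,
sorry-free and by name, the pieces of the strategist's STRATEGY-CENSUS that are statements of logic
over already-landed theorems:

* `MartingaleToSLE6_of_subs` — the GLUE of the proposed typed split of r5 into the two named
  percolation inputs of the Smirnov / Kemppainen–Smirnov scheme at `q = 1`, both typed verbatim in the
  tree (sibling route `CardyComplexCone`, `…CaratheodoryNetSlitUniformity`):
  `PercParaClockData` (clock-form martingale approximation of SOME lattice variable `X` by the spin-1/3
  half-plane observable `paraObservableProcess`, along every discretisation family read through
  Carathéodory-convergent uniformizers — the open core, DCS 2012 Conj. 8.7 in the form the martingale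
  method consumes) and `PercFaceBoxTight` (Kemppainen–Smirnov box tightness of the raw medial polyline
  in the oriented face domains — KS 2017 Prop. 3.2 / Thms 3.9–3.10 from Condition G2, i.e. RSW on ℤ²).
  `PercParaClockData → PercFaceBoxTight → MartingaleToSLE6`, through the landed
  `martingaleToSLE6_of_percFaceBoxTight` (the antecedent `TemplateCanonicalLimit` is discarded: it is
  idle beyond conditioning step `n = 0`, `percSlitExpectation_eq_integral_pin`,
  `not_isZdAdmissible_rendering_of_pin`).
* `sle6InterfaceLimit_of_subs`, `cardyFormulaZ2_of_subs` — what the two children give JOINTLY: the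
  consequent r6 outright, hence the sub-problem (through the PROVED item `SLE6ToCardy`,
  `cardyDualCurrentSLE6ToCardy_proof`). Neither child alone is claimed to give either.
* `cardyFormulaZ2_of_martingaleToSLE6_of_templateCanonicalLimit`,
  `martingaleToSLE6_iff_summit_and_lift_of_templateCanonicalLimit` — WHERE r5 SITS: under its own
  antecedent r9 (which r2 and r4 give by modus ponens in the route's logic) the crux is equivalent to
  `CardyFormulaZ2 ∧ (CardyFormulaZ2 → SLE6InterfaceLimit)`, i.e. the summit conjunct plus the
  Camia–Newman / Binder–Chayes–Lei lift; so no line for r5 as typed is short of the summit unless it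
  extracts fixed-mesh, cross-carrier information from `TemplateCanonicalLimit`, which that statement
  (rigid carriers `(E δ).Ω = D.carrier`, limits per carrier) does not carry.

References: Smirnov, ICM 2006, Conj. 4; Duminil-Copin–Smirnov 2012 (Clay lecture notes), §6 and
Conj. 8.7; Chelkak–Duminil-Copin–Hongler–Kemppainen–Smirnov, C. R. Acad. Sci. 2014, §§2–3;
Kemppainen–Smirnov, Ann. Probab. 2017, Prop. 3.2, Thms 3.9–3.10; Camia–Newman 2007;
Binder–Chayes–Lei 2010 (arXiv:1004.4673).
(buildfix 2026-08-20: comment-only re-land to re-enqueue the module build after its blocking imports were repaired; no declaration changed.)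
-/

namespace Summit.CriticalPhenomena.CardyFormulaZ2.Theorems

open Summit.CriticalPhenomena.CardyFormulaZ2.Cruxes.ParafermionToSLESixFamilies.CaratheodoryNetSlitUniformity
  (PercKSBoxData PercParaClockData PercFaceBoxTight)
open Summit.CriticalPhenomena.CardyFormulaZ2.Cruxes.ParafermionToSLESixFamilies.FaceKernel
  (percKSBoxData_of_boxTight)
open Summit.CriticalPhenomena.CardyFormulaZ2.Theses.CardyDualCurrent
  (TemplateCanonicalLimit SLE6InterfaceLimit MartingaleToSLE6 SLE6ToCardy)

/-! ### The glue of the split `PercParaClockData → PercFaceBoxTight → MartingaleToSLE6` -/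

/-- **Glue of the Kemppainen–Smirnov split of r5.** Clock-form martingale approximation by the
spin-1/3 half-plane observable (`PercParaClockData`) and Kemppainen–Smirnov box tightness of the bond
interfaces in the oriented face domains (`PercFaceBoxTight`) give the crux `MartingaleToSLE6` by name —
through `martingaleToSLE6_of_percFaceBoxTight`, feeding it the clock data unconditionally (the template
antecedent is not used). (Duminil-Copin–Smirnov 2012, §6; Kemppainen–Smirnov 2017, Thm 1.4.)
[folklore] -/
theorem MartingaleToSLE6_of_subs : PercParaClockData → PercFaceBoxTight → MartingaleToSLE6 :=
  fun hC hB => martingaleToSLE6_of_percFaceBoxTight hB (fun _ => hC)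

/-- The same glue with the Kemppainen–Smirnov datum in its packaged form `PercKSBoxData`
(approximating domains + uniformizers + box clause) instead of the face-domain box tightness.
[folklore] -/
theorem MartingaleToSLE6_of_clockData_of_ksBoxData :
    PercParaClockData → PercKSBoxData → MartingaleToSLE6 :=
  fun hC hKS => martingaleToSLE6_of_percKSBoxData hKS (fun _ => hC)

/-! ### What the children give jointly -/

/-- **The two children give the consequent r6 outright.** `PercParaClockData` and `PercFaceBoxTight`
together prove `SLE6InterfaceLimit` (SLE₆ along every discretisation family of every Dobrushin
domain) with no template hypothesis: `percKSBoxData_of_boxTight` then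
`sle6InterfaceLimit_of_percKSBoxData_of_percParaClockData`. [folklore] -/
theorem sle6InterfaceLimit_of_subs : PercParaClockData → PercFaceBoxTight → SLE6InterfaceLimit :=
  fun hC hB => sle6InterfaceLimit_of_percKSBoxData_of_percParaClockData (percKSBoxData_of_boxTight hB) hC

/-- **… hence the sub-problem.** Jointly the two children prove `CardyFormulaZ2`, through the PROVED
route item `SLE6ToCardy` (`cardyDualCurrentSLE6ToCardy_proof`). Neither child is claimed to do so
alone: the split is summit-strength only jointly, as every decomposition of r5 must be (see
`martingaleToSLE6_iff_summit_and_lift_of_templateCanonicalLimit`). [folklore] -/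
theorem cardyFormulaZ2_of_subs : PercParaClockData → PercFaceBoxTight → _root_.CardyFormulaZ2 :=
  fun hC hB => cardyDualCurrentSLE6ToCardy_proof (sle6InterfaceLimit_of_subs hC hB)

/-! ### Where r5 sits relative to the summit -/

/-- **r5 with its antecedent gives the summit conjunct.** `MartingaleToSLE6` and
`TemplateCanonicalLimit` give `CardyFormulaZ2` (modus ponens, then the proved `SLE6ToCardy`).
[folklore] -/
theorem cardyFormulaZ2_of_martingaleToSLE6_of_templateCanonicalLimit :
    MartingaleToSLE6 → TemplateCanonicalLimit → _root_.CardyFormulaZ2 :=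
  fun h5 h9 => cardyDualCurrentSLE6ToCardy_proof (h5 h9)

/-- **Summit-strength certificate for r5.** Under its antecedent `TemplateCanonicalLimit` the crux
`MartingaleToSLE6` is equivalent to the summit conjunct together with the beyond-summit lift
`CardyFormulaZ2 → SLE6InterfaceLimit` (Camia–Newman 2007 / Binder–Chayes–Lei 2010 on bond-ℤ²): the
crux is `SLE6InterfaceLimit` (`martingaleToSLE6_iff_sle6InterfaceLimit_of_templateCanonicalLimit`),
which splits as `S ∧ (S → SLE6InterfaceLimit)` through the proved `SLE6ToCardy`. [folklore] -/
theorem martingaleToSLE6_iff_summit_and_lift_of_templateCanonicalLimit :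
    TemplateCanonicalLimit →
      (MartingaleToSLE6 ↔ (_root_.CardyFormulaZ2 ∧ (_root_.CardyFormulaZ2 → SLE6InterfaceLimit))) :=
  fun h9 =>
    ⟨fun h5 => ⟨cardyDualCurrentSLE6ToCardy_proof (h5 h9), fun _ => h5 h9⟩,
      fun h _ => h.2 h.1⟩

/-- **The lift alone already gives r5 under the summit.** If `CardyFormulaZ2` holds then
`MartingaleToSLE6` follows from the lift `CardyFormulaZ2 → SLE6InterfaceLimit` (the antecedent is
discarded): the "summit cut" of r5, recorded for the census. [folklore] -/
theorem martingaleToSLE6_of_summit_of_lift :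
    _root_.CardyFormulaZ2 → (_root_.CardyFormulaZ2 → SLE6InterfaceLimit) → MartingaleToSLE6 :=
  fun hS hL _ => hL hS

end Summit.CriticalPhenomena.CardyFormulaZ2.Theorems
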